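import Literature.MathematicalPhysics.QuantumManyBody.GroundStateFeynmanKacWitnessBoundary
import Literature.MathematicalPhysics.QuantumManyBody.GroundStateFeynmanKacDisplacement
import Literature.Probability.Process.BrownianRunningMaxBounds
import HarnessLib

/-!
# Route BECCutLineWeakDisorder — `WitnessTransfer`, hard-sphere vanishing I:
# normalised linear combinations of the `3N` Brownian coordinates

Support file (does not close the item) for item stmt-AtomisticToContinuum-14978
(`Summit.AtomisticToContinuum.BoseEinsteinCondensation.Theses.BECCutLineWeakDisorder`, decl
`WitnessTransfer`), stub `stub_vanish_hardSphere` (hard-sphere case of (E2) `stub_vanish`) of line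
`Sketch`. The Feynman–Kac sample space `PathSpace N` carries `3N` independent canonical Brownian
coordinates `b_s(ω i k)` under `wienerPaths N`; the radial component of the relative motion of a
pair of world-lines is a normalised linear combination `∑_p c_p b_s(ω_p)`, `∑_p c_p² = 1`, of them.
We prove that such a combination is a (pre-)Brownian motion and deduce the small-ball bound for
its one-sided running maximum:

* `isPreBrownianReal_pathCoord`, `iIndepFun_pathCoord` — each coordinate is a pre-Brownian motion and the
  coordinates are independent (flattening `PathSpace N ≃ᵐ (Fin N × Fin 3 → path)`);
* `isGaussianProcess_coordComb`, `integral_coordComb`, `covariance_coordComb` — `∑_p c_p b(ω_p)` is a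
  centred Gaussian process with covariance `(∑_p c_p²) (s ∧ t)`;
* `isPreBrownianReal_coordComb` — for `∑_p c_p² = 1` it is a pre-Brownian motion
  (Revuz–Yor, Ch. I Ex. (1.11));
* `measure_forall_coordComb_lt_le` — `P(∀ r ≤ s, ∑_p c_p b_r(ω_p) < m) ≤ 2 √(m/√s)` for
  `0 < m ≤ √s` (transfer of the canonical small-ball bound `measure_forall_brownian_lt_le`).

## References

* D. Revuz, M. Yor, *Continuous Martingales and Brownian Motion* (1999), Ch. I Ex. (1.11),
  Ch. II (1.7). [RevuzYor1999]
* K. L. Chung, Z. Zhao, *From Brownian Motion to Schrödinger's Equation* (1995), Thm 3.17.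
  [ChungZhao1995]
-/

noncomputable section

open MeasureTheory ProbabilityTheory Filter Set Metric
open scoped ENNReal NNReal Topology

namespace Summit.AtomisticToContinuum.BoseEinsteinCondensation.Theorems.CutLineWitness

open Literature.MathematicalPhysics.QuantumManyBody.BoseGas
open Literature.Probability.Process

/-! ### The Brownian coordinates of the Feynman–Kac sample space -/

/-- Each coordinate process `(t, ω) ↦ b_t(ω i k)` is a pre-Brownian motion under `wienerPaths N`
(the coordinate map is measure preserving onto the pre-Wiener measure). [folklore] -/
theorem isPreBrownianReal_pathCoord {N : ℕ} (i : Fin N) (k : Fin 3) :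
    IsPreBrownianReal (fun t (ω : PathSpace N) => brownian t (ω i k)) (wienerPaths N) where
  hasLaw I :=
    (Literature.Probability.RandomPlanarGeometry.isPreBrownianReal_brownian.hasLaw I).fun_comp
      (measurePreserving_apply₂ i k).hasLaw

/-- **The `3N` path coordinates `ω ↦ ω i k` are independent** under `wienerPaths N` (the flattening
to `Fin N × Fin 3 → path` is measure preserving onto the product of `3N` pre-Wiener measures).
[folklore] -/
theorem iIndepFun_pathCoord {N : ℕ} :
    iIndepFun (fun (p : Fin N × Fin 3) (ω : PathSpace N) => ω p.1 p.2) (wienerPaths N) := by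
  haveI := Literature.Probability.RandomPlanarGeometry.isProbabilityMeasure_preWienerMeasure'
  rw [iIndepFun_iff_map_fun_eq_pi_map
    (fun p => ((measurable_pi_apply p.2).comp (measurable_pi_apply p.1)).aemeasurable)]
  have h1 : (wienerPaths N).map (fun (ω : PathSpace N) (p : Fin N × Fin 3) => ω p.1 p.2) =
      Measure.pi fun _ : Fin N × Fin 3 => preWienerMeasure :=
    measurePreserving_flatten.map_eq
  rw [h1]
  congr 1
  funext p
  exact (measurePreserving_apply₂ p.1 p.2).map_eq.symm

/-! ### Linear combinations of the coordinates -/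

/-- The marginals of `∑_p c_p b_s(ω_p)` are measurable. [folklore] -/
@[fun_prop]
theorem measurable_coordComb {N : ℕ} (c : Fin N × Fin 3 → ℝ) (s : ℝ≥0) :
    Measurable fun ω : PathSpace N => ∑ p, c p * brownian s (ω p.1 p.2) :=
  Finset.measurable_sum _ fun p _ =>
    ((measurable_brownian s).comp ((measurable_pi_apply p.2).comp (measurable_pi_apply p.1))).const_mul _

/-- Every path of `∑_p c_p b_s(ω_p)` is continuous. [folklore] -/
theorem continuous_coordComb {N : ℕ} (c : Fin N × Fin 3 → ℝ) (ω : PathSpace N) :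
    Continuous fun s : ℝ≥0 => ∑ p, c p * brownian s (ω p.1 p.2) :=
  continuous_finsetSum _ fun p _ => continuous_const.mul (continuous_brownian (ω p.1 p.2))

/-- `∑_p c_p b(ω_p)` is a Gaussian process: on every finite set of times it is the sum of the
independent Gaussian vectors `c_p (b_t(ω_p))_t`. [folklore] -/
theorem isGaussianProcess_coordComb {N : ℕ} (c : Fin N × Fin 3 → ℝ) :
    IsGaussianProcess (fun s (ω : PathSpace N) => ∑ p, c p * brownian s (ω p.1 p.2))
      (wienerPaths N) := by
  refine ⟨fun I => ?_⟩
  set Y : Fin N × Fin 3 → PathSpace N → (I → ℝ) :=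
    fun p ω => c p • I.restrict fun t => brownian t (ω p.1 p.2) with hY
  have hYg : ∀ p, HasGaussianLaw (Y p) (wienerPaths N) := fun p =>
    ((isPreBrownianReal_pathCoord p.1 p.2).isGaussianProcess.hasGaussianLaw I).fun_smul (c p)
  have hind : iIndepFun Y (wienerPaths N) :=
    iIndepFun_pathCoord.comp (fun p (η : ℝ≥0 → ℝ) => c p • I.restrict fun t => brownian t η)
      fun p => ((Finset.measurable_restrict I).comp
        (measurable_pi_lambda _ measurable_brownian)).const_smul (c p)
  have hsum := hind.hasGaussianLaw_fun_sum hYg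
  have heq : (fun ω : PathSpace N => I.restrict fun t => ∑ p, c p * brownian t (ω p.1 p.2)) =
      fun ω => ∑ p, Y p ω := by
    funext ω
    ext t
    simp [hY, Finset.sum_apply, smul_eq_mul]
  show HasGaussianLaw (fun ω : PathSpace N => I.restrict fun t => ∑ p, c p * brownian t (ω p.1 p.2))
    (wienerPaths N)
  rw [heq]
  exact hsum

/-- `∑_p c_p b_s(ω_p)` is centred. [folklore] -/
theorem integral_coordComb {N : ℕ} (c : Fin N × Fin 3 → ℝ) (s : ℝ≥0) :
    ∫ ω, (∑ p, c p * brownian s (ω p.1 p.2)) ∂wienerPaths N = 0 := by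
  rw [integral_finsetSum _ fun p _ =>
    ((isPreBrownianReal_pathCoord (N := N) p.1 p.2).integrable_eval s).const_mul (c p)]
  refine Finset.sum_eq_zero fun p _ => ?_
  rw [integral_const_mul]
  have h0 : ∫ ω, brownian s (ω p.1 p.2) ∂wienerPaths N = 0 :=
    (isPreBrownianReal_pathCoord (N := N) p.1 p.2).integral_eval s
  rw [h0, mul_zero]

/-- Covariance of `∑_p c_p b(ω_p)`: `(∑_p c_p²) · (s ∧ t)` (distinct coordinates are independent,
hence uncorrelated). [folklore] -/
theorem covariance_coordComb {N : ℕ} (c : Fin N × Fin 3 → ℝ) (s t : ℝ≥0) :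
    cov[fun ω : PathSpace N => ∑ p, c p * brownian s (ω p.1 p.2),
      fun ω : PathSpace N => ∑ p, c p * brownian t (ω p.1 p.2); wienerPaths N] =
      (∑ p, c p ^ 2) * min (s : ℝ) t := by
  have m : ∀ (r : ℝ≥0) (p : Fin N × Fin 3),
      MemLp (fun ω : PathSpace N => brownian r (ω p.1 p.2)) 2 (wienerPaths N) := fun r p =>
    ((isPreBrownianReal_pathCoord p.1 p.2).isGaussianProcess.hasGaussianLaw_eval r).memLp_two
  rw [covariance_fun_sum_fun_sum (fun p => (m s p).const_mul (c p))
    (fun p => (m t p).const_mul (c p))]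
  have hcov : ∀ p q : Fin N × Fin 3,
      cov[fun ω : PathSpace N => c p * brownian s (ω p.1 p.2),
        fun ω : PathSpace N => c q * brownian t (ω q.1 q.2); wienerPaths N] =
        if p = q then c p ^ 2 * min (s : ℝ) t else 0 := by
    intro p q
    rw [covariance_const_mul_left, covariance_const_mul_right]
    split_ifs with hpq
    · subst hpq
      rw [(isPreBrownianReal_pathCoord p.1 p.2).covariance_fun_eval, NNReal.coe_min]
      ring
    · have hind : IndepFun (fun ω : PathSpace N => brownian s (ω p.1 p.2))
          (fun ω : PathSpace N => brownian t (ω q.1 q.2)) (wienerPaths N) :=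
        (iIndepFun_pathCoord.indepFun hpq).comp (measurable_brownian s) (measurable_brownian t)
      rw [hind.covariance_eq_zero (m s p) (m t q), mul_zero, mul_zero]
  rw [Finset.sum_congr rfl fun p _ => Finset.sum_congr rfl fun q _ => hcov p q]
  simp [Finset.sum_ite_eq, Finset.sum_mul]

/-- **A normalised linear combination `∑_p c_p b(ω_p)`, `∑_p c_p² = 1`, of the independent
Brownian coordinates is a Brownian motion** (centred Gaussian process with covariance `s ∧ t`;
Revuz–Yor (1999), Ch. I Ex. (1.11)). [folklore] -/
theorem isPreBrownianReal_coordComb {N : ℕ} (c : Fin N × Fin 3 → ℝ) (hc : ∑ p, c p ^ 2 = 1) :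
    IsPreBrownianReal (fun s (ω : PathSpace N) => ∑ p, c p * brownian s (ω p.1 p.2))
      (wienerPaths N) := by
  refine (isGaussianProcess_coordComb c).isPreBrownianReal_of_covariance
    (fun s => integral_coordComb c s) fun s t hst => ?_
  have h := covariance_coordComb c s t
  rw [hc, one_mul, min_eq_left (show (s : ℝ) ≤ t from hst)] at h
  exact h

/-- **Small-ball bound for the one-sided running maximum of `∑_p c_p b(ω_p)`** (`∑_p c_p² = 1`):
`P(∀ r ≤ s, ∑_p c_p b_r(ω_p) < m) ≤ 2 √(m/√s)` for `0 < m ≤ √s` (Durrett (2019), Thm 7.5.5, transferred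
through the common law of the paths). [folklore] -/
theorem measure_forall_coordComb_lt_le {N : ℕ} (c : Fin N × Fin 3 → ℝ) (hc : ∑ p, c p ^ 2 = 1)
    {s : ℝ≥0} {m : ℝ} (hs : 0 < s) (hm : 0 < m) (hms : m ≤ Real.sqrt s) :
    wienerPaths N {ω | ∀ r ≤ s, ∑ p, c p * brownian r (ω p.1 p.2) < m} ≤
      ENNReal.ofReal (2 * Real.sqrt (m / Real.sqrt s)) :=
  measure_forall_lt_le_of_isPreBrownianReal (isPreBrownianReal_coordComb c hc)
    (measurable_coordComb c) (continuous_coordComb c) hs hm hms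

end Summit.AtomisticToContinuum.BoseEinsteinCondensation.Theorems.CutLineWitness
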